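import Summits.CriticalPhenomena.PercolationContinuityZ3.Theorems.PercNearOneGluingNoHeavyLowerTailRestrictedAttachmentExchange
import HarnessLib

/-!
# `NoHeavyLowerTail` (stmt-CriticalPhenomena-4575) — RMAX, the hypothesis-free form of the restricted-attachment exchange:
# typed reduction RMAX ⇒ REX ⇒ crux

Support file (lemma factory #8 `prim-lf-8`, gen 9; `--supports stmt-CriticalPhenomena-4575`).  No definitions, no named facts,
no sorries.  `μ = prodBernoulli w` on `Fin n`, relays `A`, level `j`, `π(v) = {a ∈ A : v ↔ a}`, `N = |π(o)|`, `L_v = {|π(v)| ≤ j}`,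
`H_v = {|π(v)| > j}`, `U = {o ↔ Q} = ⋃_{x∈Q} {o ↔ x}`.

**RMAX (conjecture, prim-lf-8 CANDIDATES v9 B9-1; the "multi-relay BHK inequality").**  For every weighted graph, every `q ∈ A`,
every nonempty `Q ⊆ A ∖ q` and every `o ∉ A` — with NO hypothesis relating `q` to `Q` —
  THERE IS `x ∈ Q` with  `μ(U ∩ L_o ∩ H_q) · μ(H_x ∩ L_q) ≤ μ(U ∩ H_o ∩ L_q) · μ(L_x ∩ H_q)`,
i.e. the observer's exchange odds against `q` are at most the best exchange odds `μ(L_x∩H_q)/μ(H_x∩L_q)` of a member of `Q`.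
For `|Q| = 1` this is the quantitative conditioned championship exchange (van den Berg–Häggström–Kahn; tree `exchange_typePlus`);
seat census 0 violations / ≈68 000 cases (all cells `k ≤ 8`, relay observers too), ttrl2 request l.491.
* `RMaxReduction.rex_of_rmax` — RMAX implies REX (`q` beats `Q` ⇒ `μ(U, 1≤N≤j, q heavy) ≤ μ(U, N>j, q light)`): if `q` beats `Q`
  then `μ(L_x∩H_q) ≤ μ(H_x∩L_q)` for every `x ∈ Q` (`lightHeavy_le_of_beats`), so the member `x` provided by RMAX gives the
  exchange unless `μ(H_x∩L_q) = 0`; in that degenerate case `{o↔x}` carries no mass on either side and REX for `Q` follows from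
  REX for `Q ∖ x` (induction on `|Q|`).
* `noHeavyLowerTail_of_rmax` — hence RMAX closes the crux (via `noHeavyLowerTail_of_rex`).
-/

noncomputable section

namespace Summit.CriticalPhenomena.PercolationContinuityZ3.Theorems

open MeasureTheory Set Literature.Probability.LatticeModels Literature.Probability.Percolation
open scoped Classical BigOperators

variable {n : ℕ}

namespace RMaxReduction

open ConditionedChampionExchange

/-- Beating in exchange form: `S(x) ≤ S(q)` iff `μ(L_x ∩ H_q) ≤ μ(H_x ∩ L_q)` (the `L_x ∩ L_q` parts cancel). [folklore] -/
theorem lightHeavy_le_of_beats (w : Sym2 (Fin n) → unitInterval) (A : Finset (Fin n)) (x q : Fin n) (j : ℕ)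
    (hS : (prodBernoulli w).real {ω : BondConfig (Fin n) | (A.filter fun a => ω ∈ openConn x a).card ≤ j} ≤
      (prodBernoulli w).real {ω : BondConfig (Fin n) | (A.filter fun a => ω ∈ openConn q a).card ≤ j}) :
    (prodBernoulli w).real ({ω : BondConfig (Fin n) | (A.filter fun a => ω ∈ openConn x a).card ≤ j} ∩
        {ω | j < (A.filter fun a => ω ∈ openConn q a).card}) ≤
      (prodBernoulli w).real ({ω : BondConfig (Fin n) | j < (A.filter fun a => ω ∈ openConn x a).card} ∩
        {ω | (A.filter fun a => ω ∈ openConn q a).card ≤ j}) := by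
  set μ := prodBernoulli w with hμ
  set Lx : Set (BondConfig (Fin n)) := {ω | (A.filter fun a => ω ∈ openConn x a).card ≤ j} with hLx
  set Lq : Set (BondConfig (Fin n)) := {ω | (A.filter fun a => ω ∈ openConn q a).card ≤ j} with hLq
  set Hx : Set (BondConfig (Fin n)) := {ω | j < (A.filter fun a => ω ∈ openConn x a).card} with hHx
  set Hq : Set (BondConfig (Fin n)) := {ω | j < (A.filter fun a => ω ∈ openConn q a).card} with hHq
  have hmeas : ∀ s : Set (BondConfig (Fin n)), MeasurableSet s := fun _ => MeasurableSet.of_discrete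
  have e1 : μ.real Lx = μ.real (Lx ∩ Hq) + μ.real (Lx \ Hq) :=
    (measureReal_inter_add_sdiff (μ := μ) (s := Lx) (t := Hq) (hmeas _)).symm
  have e2 : μ.real Lq = μ.real (Lq ∩ Hx) + μ.real (Lq \ Hx) :=
    (measureReal_inter_add_sdiff (μ := μ) (s := Lq) (t := Hx) (hmeas _)).symm
  have e3 : Lx \ Hq = Lq \ Hx := by
    ext ω; simp only [mem_sdiff, hLx, hLq, hHx, hHq, mem_setOf_eq, not_lt]; tauto
  have e4 : Lq ∩ Hx = Hx ∩ Lq := inter_comm _ _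
  rw [e3] at e1
  rw [e4] at e2
  linarith

/-- **RMAX ⇒ REX.**  If for every graph, `q ∈ A`, nonempty `Q ⊆ A ∖ q` and `o ∉ A` some member `x ∈ Q` satisfies
`μ(U∩L_o∩H_q)·μ(H_x∩L_q) ≤ μ(U∩H_o∩L_q)·μ(L_x∩H_q)`, then REX holds: whenever `q` beats `Q`,
`μ(U ∩ {1 ≤ N ≤ j} ∩ H_q) ≤ μ(U ∩ H_o ∩ L_q)`. [this work] -/
theorem rex_of_rmax
    (hRMAX : ∀ (n : ℕ) (w : Sym2 (Fin n) → unitInterval) (A Q : Finset (Fin n)) (o q : Fin n) (j : ℕ),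
      o ∉ A → q ∈ A → Q ⊆ A.erase q → Q.Nonempty →
      ∃ x ∈ Q,
        (prodBernoulli w).real ((⋃ y ∈ Q, (openConn o y : Set (BondConfig (Fin n)))) ∩
            {ω | (A.filter fun a => ω ∈ openConn o a).card ≤ j} ∩ {ω | j < (A.filter fun a => ω ∈ openConn q a).card}) *
          (prodBernoulli w).real ({ω : BondConfig (Fin n) | j < (A.filter fun a => ω ∈ openConn x a).card} ∩
            {ω | (A.filter fun a => ω ∈ openConn q a).card ≤ j}) ≤
        (prodBernoulli w).real ((⋃ y ∈ Q, (openConn o y : Set (BondConfig (Fin n)))) ∩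
            {ω | j < (A.filter fun a => ω ∈ openConn o a).card} ∩ {ω | (A.filter fun a => ω ∈ openConn q a).card ≤ j}) *
          (prodBernoulli w).real ({ω : BondConfig (Fin n) | (A.filter fun a => ω ∈ openConn x a).card ≤ j} ∩
            {ω | j < (A.filter fun a => ω ∈ openConn q a).card}))
    (n : ℕ) (w : Sym2 (Fin n) → unitInterval) (A Q : Finset (Fin n)) (o q : Fin n) (j : ℕ)
    (ho : o ∉ A) (hq : q ∈ A) (hQ : Q ⊆ A.erase q)
    (hbeat : ∀ x ∈ Q, (prodBernoulli w).real {ω : BondConfig (Fin n) | (A.filter fun a => ω ∈ openConn x a).card ≤ j} ≤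
      (prodBernoulli w).real {ω : BondConfig (Fin n) | (A.filter fun a => ω ∈ openConn q a).card ≤ j}) :
    (prodBernoulli w).real ((⋃ x ∈ Q, (openConn o x : Set (BondConfig (Fin n)))) ∩
        {ω | 1 ≤ (A.filter fun a => ω ∈ openConn o a).card ∧ (A.filter fun a => ω ∈ openConn o a).card ≤ j} ∩
        {ω | j < (A.filter fun a => ω ∈ openConn q a).card}) ≤
      (prodBernoulli w).real ((⋃ x ∈ Q, (openConn o x : Set (BondConfig (Fin n)))) ∩
        {ω | j < (A.filter fun a => ω ∈ openConn o a).card} ∩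
        {ω | (A.filter fun a => ω ∈ openConn q a).card ≤ j}) := by
  set μ := prodBernoulli w with hμ
  set Lo : Set (BondConfig (Fin n)) := {ω | (A.filter fun a => ω ∈ openConn o a).card ≤ j} with hLo
  set Lo1 : Set (BondConfig (Fin n)) := {ω | 1 ≤ (A.filter fun a => ω ∈ openConn o a).card ∧
    (A.filter fun a => ω ∈ openConn o a).card ≤ j} with hLo1
  set Ho : Set (BondConfig (Fin n)) := {ω | j < (A.filter fun a => ω ∈ openConn o a).card} with hHo
  set Lq : Set (BondConfig (Fin n)) := {ω | (A.filter fun a => ω ∈ openConn q a).card ≤ j} with hLq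
  set Hq : Set (BondConfig (Fin n)) := {ω | j < (A.filter fun a => ω ∈ openConn q a).card} with hHq
  have hmeas : ∀ s : Set (BondConfig (Fin n)), MeasurableSet s := fun _ => MeasurableSet.of_discrete
  have hnn : ∀ s : Set (BondConfig (Fin n)), 0 ≤ μ.real s := fun _ => measureReal_nonneg
  have mono : ∀ {s t : Set (BondConfig (Fin n))}, s ⊆ t → μ.real s ≤ μ.real t :=
    fun h => measureReal_mono h (measure_ne_top μ _)
  -- it suffices to prove the version with `Lo` (the attached light event is smaller)
  suffices key : ∀ (Q' : Finset (Fin n)), Q' ⊆ Q →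
      μ.real ((⋃ x ∈ Q', (openConn o x : Set (BondConfig (Fin n)))) ∩ Lo ∩ Hq) ≤
        μ.real ((⋃ x ∈ Q', (openConn o x : Set (BondConfig (Fin n)))) ∩ Ho ∩ Lq) by
    refine le_trans (mono ?_) (key Q subset_rfl)
    rintro ω ⟨⟨hU, -, hl⟩, hh⟩; exact ⟨⟨hU, hl⟩, hh⟩
  intro Q'
  induction Q' using Finset.strongInduction with
  | H Q' ih =>
    intro hQ'
    rcases Q'.eq_empty_or_nonempty with hE | hne
    · subst hE
      simp only [Finset.notMem_empty, iUnion_of_empty, iUnion_empty, empty_inter, measureReal_empty, le_refl]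
    set U : Set (BondConfig (Fin n)) := ⋃ x ∈ Q', (openConn o x : Set (BondConfig (Fin n))) with hU
    obtain ⟨x, hxQ', hx⟩ := hRMAX n w A Q' o q j ho hq (subset_trans hQ' hQ) hne
    set Lx : Set (BondConfig (Fin n)) := {ω | (A.filter fun a => ω ∈ openConn x a).card ≤ j} with hLx
    set Hx : Set (BondConfig (Fin n)) := {ω | j < (A.filter fun a => ω ∈ openConn x a).card} with hHx
    change μ.real (U ∩ Lo ∩ Hq) * μ.real (Hx ∩ Lq) ≤ μ.real (U ∩ Ho ∩ Lq) * μ.real (Lx ∩ Hq) at hx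
    have hb : μ.real (Lx ∩ Hq) ≤ μ.real (Hx ∩ Lq) := lightHeavy_le_of_beats w A x q j (hbeat x (hQ' hxQ'))
    by_cases hpos : 0 < μ.real (Hx ∩ Lq)
    · -- the generic case: divide
      have h1 : μ.real (U ∩ Lo ∩ Hq) * μ.real (Hx ∩ Lq) ≤ μ.real (U ∩ Ho ∩ Lq) * μ.real (Hx ∩ Lq) :=
        le_trans hx (mul_le_mul_of_nonneg_left hb (hnn _))
      exact le_of_mul_le_mul_right h1 hpos
    · -- degenerate case: `μ(H_x ∩ L_q) = 0 = μ(L_x ∩ H_q)`; drop `x` from `Q'`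
      have hCC : μ.real (Hx ∩ Lq) = 0 := le_antisymm (not_lt.1 hpos) (hnn _)
      have hcc : μ.real (Lx ∩ Hq) = 0 := le_antisymm (hCC ▸ hb) (hnn _)
      set Q'' := Q'.erase x with hQ''
      set U' : Set (BondConfig (Fin n)) := ⋃ y ∈ Q'', (openConn o y : Set (BondConfig (Fin n))) with hU'
      have hsub : Q'' ⊂ Q' := Finset.erase_ssubset hxQ'
      have IH := ih Q'' hsub (subset_trans hsub.subset hQ')
      change μ.real (U' ∩ Lo ∩ Hq) ≤ μ.real (U' ∩ Ho ∩ Lq) at IH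
      -- `U ∩ Lo ∩ Hq ⊆ (U' ∩ Lo ∩ Hq) ∪ ({o↔x} ∩ Lx ∩ Hq)`
      have i1 : U ∩ Lo ∩ Hq ⊆ (U' ∩ Lo ∩ Hq) ∪ ((openConn o x : Set (BondConfig (Fin n))) ∩ Lx ∩ Hq) := by
        rintro ω ⟨⟨hUω, hl⟩, hh⟩
        by_cases hox : ω ∈ (openConn o x : Set (BondConfig (Fin n)))
        · refine Or.inr ⟨⟨hox, ?_⟩, hh⟩
          show (A.filter fun a => ω ∈ openConn x a).card ≤ j
          rw [← filter_eq_of_openConn A hox]; exact hl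
        · refine Or.inl ⟨⟨?_, hl⟩, hh⟩
          rw [hU] at hUω
          obtain ⟨y, hy, hωy⟩ := mem_iUnion₂.1 hUω
          have hyx : y ≠ x := by rintro rfl; exact hox hωy
          exact mem_biUnion (Finset.mem_erase.2 ⟨hyx, hy⟩) hωy
      have i2 : U' ∩ Ho ∩ Lq ⊆ U ∩ Ho ∩ Lq := by
        rintro ω ⟨⟨hUω, hh⟩, hl⟩
        refine ⟨⟨?_, hh⟩, hl⟩
        rw [hU'] at hUω
        obtain ⟨y, hy, hωy⟩ := mem_iUnion₂.1 hUω
        exact mem_biUnion (Finset.mem_of_mem_erase hy) hωy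
      have hz : μ.real ((openConn o x : Set (BondConfig (Fin n))) ∩ Lx ∩ Hq) = 0 :=
        le_antisymm (le_trans (mono (show (openConn o x : Set (BondConfig (Fin n))) ∩ Lx ∩ Hq ⊆ Lx ∩ Hq from
          fun ω hω => ⟨hω.1.2, hω.2⟩)) hcc.le) (hnn _)
      calc μ.real (U ∩ Lo ∩ Hq)
          ≤ μ.real ((U' ∩ Lo ∩ Hq) ∪ ((openConn o x : Set (BondConfig (Fin n))) ∩ Lx ∩ Hq)) := mono i1
        _ ≤ μ.real (U' ∩ Lo ∩ Hq) + μ.real ((openConn o x : Set (BondConfig (Fin n))) ∩ Lx ∩ Hq) :=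
            measureReal_union_le _ _
        _ = μ.real (U' ∩ Lo ∩ Hq) := by rw [hz, add_zero]
        _ ≤ μ.real (U' ∩ Ho ∩ Lq) := IH
        _ ≤ μ.real (U ∩ Ho ∩ Lq) := mono i2

end RMaxReduction

/-- **RMAX closes the crux.**  The hypothesis-free multi-relay exchange RMAX (for all graphs, levels, `q ∈ A`, nonempty `Q ⊆ A∖q`,
`o ∉ A`: some `x ∈ Q` with `μ(U∩L_o∩H_q)·μ(H_x∩L_q) ≤ μ(U∩H_o∩L_q)·μ(L_x∩H_q)`) implies `NoHeavyLowerTail`, through REX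
(`RMaxReduction.rex_of_rmax`) and `noHeavyLowerTail_of_rex`. [this work] -/
theorem noHeavyLowerTail_of_rmax
    (hRMAX : ∀ (n : ℕ) (w : Sym2 (Fin n) → unitInterval) (A Q : Finset (Fin n)) (o q : Fin n) (j : ℕ),
      o ∉ A → q ∈ A → Q ⊆ A.erase q → Q.Nonempty →
      ∃ x ∈ Q,
        (prodBernoulli w).real ((⋃ y ∈ Q, (openConn o y : Set (BondConfig (Fin n)))) ∩
            {ω | (A.filter fun a => ω ∈ openConn o a).card ≤ j} ∩ {ω | j < (A.filter fun a => ω ∈ openConn q a).card}) *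
          (prodBernoulli w).real ({ω : BondConfig (Fin n) | j < (A.filter fun a => ω ∈ openConn x a).card} ∩
            {ω | (A.filter fun a => ω ∈ openConn q a).card ≤ j}) ≤
        (prodBernoulli w).real ((⋃ y ∈ Q, (openConn o y : Set (BondConfig (Fin n)))) ∩
            {ω | j < (A.filter fun a => ω ∈ openConn o a).card} ∩ {ω | (A.filter fun a => ω ∈ openConn q a).card ≤ j}) *
          (prodBernoulli w).real ({ω : BondConfig (Fin n) | (A.filter fun a => ω ∈ openConn x a).card ≤ j} ∩
            {ω | j < (A.filter fun a => ω ∈ openConn q a).card})) :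
    Summit.CriticalPhenomena.PercolationContinuityZ3.Theses.PercNearOneGluing.NoHeavyLowerTail :=
  RestrictedAttachmentExchange.noHeavyLowerTail_of_rex fun n w A Q o q j ho hq hQ hbeat =>
    RMaxReduction.rex_of_rmax hRMAX n w A Q o q j ho hq hQ hbeat

end Summit.CriticalPhenomena.PercolationContinuityZ3.Theorems

end
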